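import Literature.Geometry.DiscreteGeometry.KerteszNinePointsHemisphere
import Literature.Geometry.DiscreteGeometry.KissingAngleBounds
import HarnessLib

/-!
# Kertész 1994, second step: the three northern points of a nine-point one-sided arrangement

Topic `Literature/Geometry/DiscreteGeometry`; provefact instalment for the named fact
`kertesz1994_ninePointsHemisphere` (`KerteszNinePointsHemisphere.lean`: nine unit vectors of `ℝ³` in a
closed hemisphere `⟪e, ·⟫ ≥ 0`, pairwise at distance `≥ 1`, have six points ON the equator — G. Kertész,
*Nine points on the hemisphere*, Colloq. Math. Soc. János Bolyai 63 (1994) 189–196).  Kertész's proof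
"proceeds by repeatedly limiting the range in which the points might be found. Thus, it is first shown
that exactly six of the points must have latitude less than `30°`. The three 'northern' points are
shown to have latitude greater than `45°` and less than `60°`, and so on; until at the end the
latitudes, and relative longitudes, are completely determined" (R. Dawson, Zbl 0822.52005).  The first
step is the tree's `nine_point_structure` (three points of height `> 1/2`, six of height `< 1/2`).
This file PROVES, with no new definitions or named facts:

* `inner_add_add_le_sqrt_six`, `exists_inner_le_sqrt_six_div_three`,
  `exists_high_inner_le_sqrt_six_div_three` — the **centroid bound**: three unit vectors pairwise
  `≥ 60°` apart have `‖h₁ + h₂ + h₃‖² ≤ 6`, so `⟪e, h₁ + h₂ + h₃⟫ ≤ √6` and ONE of the three northern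
  points has height `≤ √6/3 = cos 35.26…°` (all three sit exactly there in Kertész's configuration,
  the cuboctahedron minus a triangle);
* `half_sub_mul_le_half_sqrt`, `mul_cos_le_half_of_high_low`, `cos_le_sqrt_third_of_low_low` — the
  pairwise **azimuth bounds** about the pole in the polar coordinates of Musin's projection argument
  (`OneSidedKissingNumberThree.lean`): high–low `r cos Δ ≤ 1/2` WHATEVER the low height (lifting a
  low point only pushes it away azimuthally), low–low `cos Δ ≤ √(1/3)`;
* `six_sorted_angles_one_high_false`, `half_lt_inner_sq_of_six_low`, **`half_lt_inner_sq_of_high`**,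
  `one_sub_inner_sq_lt_half_of_high` — the **azimuth budget** `5 · arccos √(1/3) + 2 · (π/4) > 2π`:
  the six low azimuths have cyclic gaps `≥ arccos √(1/3) > 0.9552` and a northern point of
  horizontal radius `r ≥ √2/2` would need offsets `≥ π/4` from both ends of its gap; hence every
  northern point has `⟪e, v⟫² > 1/2`, i.e. **latitude `> 45°`** (the same budget gives colatitude
  `≤ 43.3°`; we vendor the printed `45°`).

WHAT THIS IS NOT: the discharge.  Still to prove (the cell's blueprint HOME/cf-lit/kertesz/): the
other covers of the azimuth budget (latitude `< 60°` for all three, one northern point per low gap,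
only the gap pattern `(2,2,2)` survives), the lift-penalty-versus-bunching-gain inequality, and the
equality case at colatitude `arcsin (1/√3)`.

## References
* G. Kertész, *Nine points on the hemisphere*, in: Intuitive Geometry (Szeged 1991), Colloq. Math.
  Soc. János Bolyai 63, North-Holland (1994) 189–196; review R. Dawson, Zbl 0822.52005. [`Kertesz1994`]
* O. R. Musin, *The one-sided kissing number in four dimensions*, Period. Math. Hungar. 53 (2006)
  209–225 = arXiv:math/0511071, §2 (projection along meridians). [`Musin2006`]
* P. Brass, W. Moser, J. Pach, *Research Problems in Discrete Geometry* (2005), §2.4. [`BrassMoserPach2005`]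
-/

noncomputable section

namespace Literature.Geometry.DiscreteGeometry

open Real RealInnerProductSpace Finset

/-- Unit vectors at distance `≥ 1` have inner product `≤ 1/2`. [folklore] -/
private theorem inner_le_half_of_dist' {v w : EuclideanSpace ℝ (Fin 3)} (hv : ‖v‖ = 1) (hw : ‖w‖ = 1)
    (h : 1 ≤ dist v w) : ⟪v, w⟫ ≤ 1 / 2 := by
  have h2 : dist v w ^ 2 = 2 - 2 * ⟪v, w⟫ := by
    rw [dist_eq_norm, norm_sub_sq_real, hv, hw]; ring
  nlinarith [h, h2, dist_nonneg (x := v) (y := w)]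

/-! ### The centroid bound for three mutually distant points (towards "latitude < 60°") -/

/-- **Centroid bound.** Three unit vectors pairwise at inner product `≤ 1/2` (angular distance
`≥ 60°`) have `‖h₁ + h₂ + h₃‖² = 3 + 2 Σ ⟪hᵢ, hⱼ⟫ ≤ 6`, hence `⟪e, h₁ + h₂ + h₃⟫ ≤ √6` for every unit
vector `e`: their mean height above any equator is at most `√6/3 = cos 35.26°`.  (Equality iff
the three points are pairwise at exactly `60°` with centroid on the axis `e` — the triangle of the
cuboctahedron minus a triangle.)  [cite: Kertesz1994, proof (range-narrowing, northern latitudes)] -/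
theorem inner_add_add_le_sqrt_six {e h₁ h₂ h₃ : EuclideanSpace ℝ (Fin 3)} (he : ‖e‖ = 1)
    (hn₁ : ‖h₁‖ = 1) (hn₂ : ‖h₂‖ = 1) (hn₃ : ‖h₃‖ = 1)
    (h₁₂ : ⟪h₁, h₂⟫ ≤ 1 / 2) (h₁₃ : ⟪h₁, h₃⟫ ≤ 1 / 2) (h₂₃ : ⟪h₂, h₃⟫ ≤ 1 / 2) :
    ⟪e, h₁ + h₂ + h₃⟫ ≤ √6 := by
  have hsq : ‖h₁ + h₂ + h₃‖ ^ 2 ≤ 6 := by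
    have hx : ‖h₁ + h₂ + h₃‖ ^ 2 =
        ‖h₁‖ ^ 2 + ‖h₂‖ ^ 2 + ‖h₃‖ ^ 2 + 2 * (⟪h₁, h₂⟫ + ⟪h₁, h₃⟫ + ⟪h₂, h₃⟫) := by
      rw [norm_add_sq_real, norm_add_sq_real, inner_add_left]
      ring
    rw [hx, hn₁, hn₂, hn₃]
    linarith
  have hnorm : ‖h₁ + h₂ + h₃‖ ≤ √6 := by
    rw [← Real.sqrt_sq (norm_nonneg (h₁ + h₂ + h₃))]
    exact Real.sqrt_le_sqrt hsq
  calc ⟪e, h₁ + h₂ + h₃⟫ ≤ ‖e‖ * ‖h₁ + h₂ + h₃‖ := real_inner_le_norm _ _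
    _ ≤ √6 := by rw [he, one_mul]; exact hnorm

/-- **One of three mutually distant points has height `≤ √6/3`** above any equator (the minimum is
at most the mean, `inner_add_add_le_sqrt_six`): three unit vectors pairwise at inner product
`≤ 1/2` cannot all lie in the open cap `⟪e, ·⟫ > √6/3 = cos 35.26…°` — the cap of angular radius
`arcsin (1/√3)` circumscribes the equilateral spherical triangle of side `60°` and holds no other
`60°`-separated triple. [cite: Kertesz1994, proof (range-narrowing, northern latitudes)] -/
theorem exists_inner_le_sqrt_six_div_three {e h₁ h₂ h₃ : EuclideanSpace ℝ (Fin 3)} (he : ‖e‖ = 1)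
    (hn₁ : ‖h₁‖ = 1) (hn₂ : ‖h₂‖ = 1) (hn₃ : ‖h₃‖ = 1)
    (h₁₂ : ⟪h₁, h₂⟫ ≤ 1 / 2) (h₁₃ : ⟪h₁, h₃⟫ ≤ 1 / 2) (h₂₃ : ⟪h₂, h₃⟫ ≤ 1 / 2) :
    ⟪e, h₁⟫ ≤ √6 / 3 ∨ ⟪e, h₂⟫ ≤ √6 / 3 ∨ ⟪e, h₃⟫ ≤ √6 / 3 := by
  by_contra h
  push Not at h
  obtain ⟨h1, h2, h3⟩ := h
  have hs := inner_add_add_le_sqrt_six he hn₁ hn₂ hn₃ h₁₂ h₁₃ h₂₃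
  rw [inner_add_right, inner_add_right] at hs
  linarith

/-- **In a nine-point one-sided arrangement some northern point has height `≤ √6/3`.**  The three
points of height `> 1/2` (`nine_point_structure`) are pairwise at distance `≥ 1`, so one of them has
`⟪e, v⟫ ≤ √6/3` (colatitude `≥ 35.26…°`, latitude `≤ 54.73…°`); in Kertész's configuration all three
have height exactly `√6/3 = √(2/3)`. [cite: Kertesz1994, proof (range-narrowing, northern latitudes)] -/
theorem exists_high_inner_le_sqrt_six_div_three {e : EuclideanSpace ℝ (Fin 3)} (he : ‖e‖ = 1)
    {T : Finset (EuclideanSpace ℝ (Fin 3))}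
    (hn : ∀ v ∈ T, ‖v‖ = 1) (hhemi : ∀ v ∈ T, 0 ≤ ⟪e, v⟫)
    (hsep : ∀ v ∈ T, ∀ w ∈ T, v ≠ w → 1 ≤ dist v w) (h9 : T.card = 9) :
    ∃ v ∈ T, 1 / 2 < ⟪e, v⟫ ∧ ⟪e, v⟫ ≤ √6 / 3 := by
  classical
  obtain ⟨hH, -, -⟩ := nine_point_structure he hn hhemi hsep h9
  obtain ⟨a, b, c, hab, hac, hbc, habc⟩ := Finset.card_eq_three.1 hH
  have ha : a ∈ T.filter fun v => 1 / 2 < ⟪e, v⟫ := by rw [habc]; simp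
  have hb : b ∈ T.filter fun v => 1 / 2 < ⟪e, v⟫ := by rw [habc]; simp
  have hc : c ∈ T.filter fun v => 1 / 2 < ⟪e, v⟫ := by rw [habc]; simp
  rw [Finset.mem_filter] at ha hb hc
  have hi : ∀ {v w}, v ∈ T → w ∈ T → v ≠ w → ⟪v, w⟫ ≤ 1 / 2 := fun hv hw hvw =>
    inner_le_half_of_dist' (hn _ hv) (hn _ hw) (hsep _ hv _ hw hvw)
  rcases exists_inner_le_sqrt_six_div_three he (hn a ha.1) (hn b hb.1) (hn c hc.1)
      (hi ha.1 hb.1 hab) (hi ha.1 hc.1 hac) (hi hb.1 hc.1 hbc) with h | h | h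
  · exact ⟨a, ha.1, ha.2, h⟩
  · exact ⟨b, hb.1, hb.2, h⟩
  · exact ⟨c, hc.1, hc.2, h⟩

/-! ### Kertész's second step, first half: every northern point has latitude `> 45°` -/

/-- **The high–low azimuth bound is monotone in the low height.**  For `0 ≤ z ≤ 1/2 ≤ w ≤ 1`,
`1/2 − w z ≤ √(1 − z²)/2`: a point of height `w ≥ 1/2` and horizontal radius `r` and a point of height
`z ≤ 1/2` and horizontal radius `s = √(1 − z²)` at inner product `≤ 1/2` have azimuths `Δ` apart
with `r s cos Δ ≤ 1/2 − w z ≤ s/2`, i.e. `r cos Δ ≤ 1/2` WHATEVER the low height (lifting a low point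
off the equator only pushes it azimuthally away from a northern point).
[cite: Kertesz1994, proof (second step: northern latitudes)] -/
theorem half_sub_mul_le_half_sqrt {w z : ℝ} (hz0 : 0 ≤ z) (hz1 : z ≤ 1 / 2) (hw0 : 1 / 2 ≤ w)
    (hw1 : w ≤ 1) : 1 / 2 - w * z ≤ √(1 - z ^ 2) / 2 := by
  have hsq : (1 - 2 * w * z) ^ 2 ≤ 1 - z ^ 2 := by
    have h1 : 0 ≤ 4 * w - z * (4 * w ^ 2 + 1) := by nlinarith
    nlinarith [mul_nonneg hz0 h1]
  have h := Real.abs_le_sqrt hsq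
  have h' : 1 - 2 * w * z ≤ √(1 - z ^ 2) := (le_abs_self _).trans h
  linarith

/-- From `cos x ≤ cos t₀` with `t₀ ∈ [0, π]` and `x ∈ [0, 2π]`: both `x` and `2π − x` are `≥ t₀`.
[folklore] -/
private theorem le_and_le_of_cos_le {t₀ x : ℝ} (htπ : t₀ ≤ π) (hx0 : 0 ≤ x)
    (hx1 : x ≤ 2 * π) (h : cos x ≤ cos t₀) : t₀ ≤ x ∧ t₀ ≤ 2 * π - x := by
  have key : ∀ y, 0 ≤ y → y ≤ π → cos y ≤ cos t₀ → t₀ ≤ y := by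
    intro y hy0 hyπ hy
    by_contra hlt
    have := Real.cos_lt_cos_of_nonneg_of_le_pi hy0 htπ (not_le.1 hlt)
    linarith
  by_cases hxπ : x ≤ π
  · exact ⟨key x hx0 hxπ h, htπ.trans (by linarith)⟩
  · push Not at hxπ
    refine ⟨htπ.trans hxπ.le, key (2 * π - x) (by linarith) (by linarith) ?_⟩
    rwa [Real.cos_two_pi_sub]

/-- `√(1/2) = √2/2`. [folklore] -/
private theorem sqrt_half_eq : √(1 / 2 : ℝ) = √2 / 2 := by
  have h : (√2 / 2) ^ 2 = (1 / 2 : ℝ) := by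
    rw [div_pow, Real.sq_sqrt (by norm_num : (0 : ℝ) ≤ 2)]; norm_num
  rw [← h, Real.sqrt_sq (by positivity)]


/-- The low–low azimuth bound: two points of heights `Zᵢ, Zⱼ ∈ [0, 1/2]` (horizontal radii `ρ`,
`ρ² = 1 − Z²`) at inner product `ρᵢ ρⱼ c + Zᵢ Zⱼ ≤ 1/2` have azimuths at an angle of cosine
`c ≤ √(1/3)` (`three_mul_sq_le_of_band`). [cite: Musin2006, §2 Thm 2 (proof)] -/
theorem cos_le_sqrt_third_of_low_low {Zi Zj ρi ρj c : ℝ} (hi0 : 0 ≤ Zi) (hi1 : Zi ≤ 1 / 2)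
    (hj0 : 0 ≤ Zj) (hj1 : Zj ≤ 1 / 2) (hρi0 : 0 ≤ ρi) (hρj0 : 0 ≤ ρj) (hρi : ρi ^ 2 = 1 - Zi ^ 2)
    (hρj : ρj ^ 2 = 1 - Zj ^ 2) (h : ρi * ρj * c + Zi * Zj ≤ 1 / 2) : c ≤ √(1 / 3) := by
  by_cases hc : c ≤ 0
  · exact hc.trans (Real.sqrt_nonneg _)
  have hc' : 0 < c := lt_of_not_ge hc
  have h3 := three_mul_sq_le_of_band hi0 hi1 hj0 hj1
  have hρρ : 0 ≤ ρi * ρj := mul_nonneg hρi0 hρj0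
  have h1 : ρi * ρj * c ≤ 1 / 2 - Zi * Zj := by linarith
  have h1' : 0 ≤ ρi * ρj * c := mul_nonneg hρρ hc'.le
  have h2 : (ρi * ρj * c) ^ 2 ≤ (1 / 2 - Zi * Zj) ^ 2 := pow_le_pow_left₀ h1' h1 2
  rw [mul_pow, mul_pow, hρi, hρj] at h2
  have h4 : 3 / 4 ≤ 1 - Zi ^ 2 := by nlinarith
  have h5 : 3 / 4 ≤ 1 - Zj ^ 2 := by nlinarith
  have h6 : 9 / 16 ≤ (1 - Zi ^ 2) * (1 - Zj ^ 2) := by nlinarith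
  have hcos2 : c ^ 2 ≤ 1 / 3 := by
    by_contra hc2
    have hc2' : 1 / 3 < c ^ 2 := lt_of_not_ge hc2
    have : (1 - Zi ^ 2) * (1 - Zj ^ 2) * (1 / 3) < (1 - Zi ^ 2) * (1 - Zj ^ 2) * c ^ 2 :=
      mul_lt_mul_of_pos_left hc2' (by linarith)
    nlinarith [h2, h3, this]
  calc c ≤ |c| := le_abs_self _
    _ ≤ √(1 / 3) := Real.abs_le_sqrt hcos2

/-- The high–low azimuth bound, height-free form: a point of height `W ∈ [1/2, 1]` and horizontal
radius `r ≥ 0` and a point of height `Z ∈ [0, 1/2]` and horizontal radius `ρ` (`ρ² = 1 − Z²`) at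
inner product `r ρ c + W Z ≤ 1/2` have azimuths at an angle of cosine `c` with `r c ≤ 1/2`
(`half_sub_mul_le_half_sqrt`). [cite: Kertesz1994, proof (second step)] -/
theorem mul_cos_le_half_of_high_low {W Z r ρ c : ℝ} (hZ0 : 0 ≤ Z) (hZ1 : Z ≤ 1 / 2)
    (hW0 : 1 / 2 ≤ W) (hW1 : W ≤ 1) (hr0 : 0 ≤ r) (hρ0 : 0 ≤ ρ) (hρ : ρ ^ 2 = 1 - Z ^ 2)
    (h : r * ρ * c + W * Z ≤ 1 / 2) : r * c ≤ 1 / 2 := by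
  by_cases hc : c ≤ 0
  · have : r * c ≤ 0 := mul_nonpos_of_nonneg_of_nonpos hr0 hc
    linarith
  have hc' : 0 < c := lt_of_not_ge hc
  have hs : 1 / 2 - W * Z ≤ √(1 - Z ^ 2) / 2 := half_sub_mul_le_half_sqrt hZ0 hZ1 hW0 hW1
  have hρeq : √(1 - Z ^ 2) = ρ := by rw [← hρ, Real.sqrt_sq hρ0]
  rw [hρeq] at hs
  have hρpos : 0 < ρ := by
    have h34 : 3 / 4 ≤ ρ ^ 2 := by rw [hρ]; nlinarith
    nlinarith
  have h1 : ρ * (r * c) ≤ ρ * (1 / 2) := by nlinarith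
  exact le_of_mul_le_mul_left h1 hρpos

/-- If `r² ≥ 1/2`, `r ≥ 0` and `r c ≤ 1/2` then `c ≤ √2/2`. [folklore] -/
private theorem cos_le_sqrt_two_div_two {r c : ℝ} (hr0 : 0 ≤ r) (hr : 1 / 2 ≤ r ^ 2)
    (h : r * c ≤ 1 / 2) : c ≤ √2 / 2 := by
  by_cases hc : c ≤ 0
  · exact hc.trans (by positivity)
  have hc' : 0 < c := lt_of_not_ge hc
  have h3 : 0 ≤ r * c := mul_nonneg hr0 hc'.le
  have h4 : (r * c) ^ 2 ≤ (1 / 2) ^ 2 := pow_le_pow_left₀ h3 h 2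
  have hcos2 : c ^ 2 ≤ 1 / 2 := by
    rw [mul_pow] at h4
    nlinarith [sq_nonneg c]
  calc c ≤ |c| := le_abs_self _
    _ ≤ √(1 / 2) := Real.abs_le_sqrt hcos2
    _ = √2 / 2 := sqrt_half_eq


/-- **The azimuth budget of six sorted low angles and one high angle.**  Six angles
`−π < t₀ < ⋯ < t₅ ≤ π` whose pairwise differences have cosine `≤ cos G` (`G ≤ π`, `G > 0.9552`)
and an angle `φ ∈ (−π, π]` with `cos (φ − tₖ) ≤ cos (π/4)` for all `k` do not exist: the six cyclic
gaps are `≥ G`, the gap containing `φ` is `≥ π/4 + π/4`, and `5 · 0.9552 + π/2 > 2π`.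
[cite: Kertesz1994, proof (second step: northern latitudes > 45°)] -/
theorem six_sorted_angles_one_high_false (t : Fin 6 → ℝ) (hmono : StrictMono t)
    (hlo : -π < t 0) (hhi : t 5 ≤ π) {G : ℝ} (hGπ : G ≤ π) (hGlo : (0.9552 : ℝ) < G)
    (hC : ∀ i j, i ≠ j → cos (t i - t j) ≤ cos G)
    (φ : ℝ) (hφlo : -π < φ) (hφhi : φ ≤ π) (hH : ∀ k, cos (φ - t k) ≤ cos (π / 4)) : False := by
  have hπ : π < 3.1416 := Real.pi_lt_d4
  have hqπ : π / 4 ≤ π := by linarith [Real.pi_pos]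
  -- LL gap bounds between sorted angles: for k < l, both t l − t k and 2π − (t l − t k) are ≥ G
  have hgap : ∀ k l : Fin 6, k < l → G ≤ t l - t k ∧ G ≤ 2 * π - (t l - t k) := by
    intro k l hkl
    have hc : cos (t l - t k) ≤ cos G := hC l k (ne_of_gt hkl)
    have h0 : 0 ≤ t l - t k := by linarith [hmono hkl]
    have h5 : t l ≤ t 5 := hmono.monotone (Fin.le_last l)
    have h0' : t 0 ≤ t k := hmono.monotone (Fin.zero_le k)
    exact le_and_le_of_cos_le hGπ h0 (by linarith) hc
  -- HL offset bounds
  have hoff : ∀ k : Fin 6, ∀ x : ℝ, (x = φ - t k ∨ x = t k - φ) → 0 ≤ x → x ≤ 2 * π →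
      π / 4 ≤ x ∧ π / 4 ≤ 2 * π - x := by
    intro k x hx hx0 hx1
    have hc : cos x ≤ cos (π / 4) := by
      rcases hx with rfl | rfl
      · exact hH k
      · rw [← Real.cos_neg, neg_sub]; exact hH k
    exact le_and_le_of_cos_le hqπ hx0 hx1 hc
  have htel : (t 1 - t 0) + (t 2 - t 1) + (t 3 - t 2) + (t 4 - t 3) + (t 5 - t 4) +
      (2 * π - (t 5 - t 0)) = 2 * π := by ring
  have g01 := (hgap 0 1 (by decide)).1
  have g12 := (hgap 1 2 (by decide)).1
  have g23 := (hgap 2 3 (by decide)).1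
  have g34 := (hgap 3 4 (by decide)).1
  have g45 := (hgap 4 5 (by decide)).1
  have g50 := (hgap 0 5 (by decide)).2
  have ht05 : t 0 < t 5 := hmono (by decide)
  have ht0 : t 0 ≤ π := by linarith
  -- locate φ
  by_cases hlo' : φ < t 0
  · -- the wrap gap is (t 0 − φ) + (2π − (t 5 − φ))
    have h1 := (hoff 0 (t 0 - φ) (Or.inr rfl) (by linarith) (by linarith)).1
    have h2 := (hoff 5 (t 5 - φ) (Or.inr rfl) (by linarith) (by linarith)).2
    linarith
  by_cases hhi' : t 5 < φ
  · have h1 := (hoff 5 (φ - t 5) (Or.inl rfl) (by linarith) (by linarith)).1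
    have h2 := (hoff 0 (φ - t 0) (Or.inl rfl) (by linarith) (by linarith)).2
    linarith
  have hlo'' : t 0 ≤ φ := not_lt.1 hlo'
  have hhi'' : φ ≤ t 5 := not_lt.1 hhi'
  -- t 0 ≤ φ ≤ t 5: φ lies in one of the five consecutive gaps, which is then ≥ π/2
  have hin : ∀ k l : Fin 6, t k ≤ φ → φ ≤ t l → π / 2 ≤ t l - t k := by
    intro k l hk hl
    have h5 : t l ≤ t 5 := hmono.monotone (Fin.le_last l)
    have h0' : t 0 ≤ t k := hmono.monotone (Fin.zero_le k)
    have h1 := (hoff k (φ - t k) (Or.inl rfl) (by linarith) (by linarith)).1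
    have h2 := (hoff l (t l - φ) (Or.inr rfl) (by linarith) (by linarith)).1
    linarith
  by_cases h1 : φ ≤ t 1
  · have := hin 0 1 hlo'' h1
    linarith
  by_cases h2 : φ ≤ t 2
  · have := hin 1 2 (le_of_lt (not_le.1 h1)) h2
    linarith
  by_cases h3 : φ ≤ t 3
  · have := hin 2 3 (le_of_lt (not_le.1 h2)) h3
    linarith
  by_cases h4 : φ ≤ t 4
  · have := hin 3 4 (le_of_lt (not_le.1 h3)) h4
    linarith
  · have := hin 4 5 (le_of_lt (not_le.1 h4)) hhi''
    linarith

/-- **Six low points leave no room for a northern point of latitude `≤ 45°`** (Kertész 1994, second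
step of the range-narrowing, first half).  Let `e` be a unit vector, `u₀, …, u₅` unit vectors with
`0 ≤ ⟪e, uₖ⟫ ≤ 1/2` pairwise at inner product `≤ 1/2`, and `v` a unit vector with `⟪e, v⟫ ≥ 1/2`
at inner product `≤ 1/2` with every `uₖ`.  Then `⟪e, v⟫² > 1/2`.  Proof (azimuth budget about
`e`): the six low azimuths, sorted, have cyclic gaps each `≥ arccos √(1/3) > 0.9552`
(`three_mul_sq_le_of_band`); the azimuth of `v` lies in one of the gaps at offsets `Δ` with
`r cos Δ ≤ 1/2` from both ends (`half_sub_mul_le_half_sqrt`, `r² = 1 − ⟪e, v⟫²`), so if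
`⟪e, v⟫² ≤ 1/2` then `cos Δ ≤ √2/2`, both offsets are `≥ π/4`, and
`5 · 0.9552 + π/2 > 2π`. [cite: Kertesz1994, proof (second step: northern latitudes > 45°)] -/
theorem half_lt_inner_sq_of_six_low {e : EuclideanSpace ℝ (Fin 3)} (he : ‖e‖ = 1)
    (u : Fin 6 → EuclideanSpace ℝ (Fin 3)) (hn : ∀ k, ‖u k‖ = 1)
    (hz0 : ∀ k, 0 ≤ ⟪e, u k⟫) (hz1 : ∀ k, ⟪e, u k⟫ ≤ 1 / 2)
    (hsep : ∀ i j, i ≠ j → ⟪u i, u j⟫ ≤ 1 / 2)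
    {v : EuclideanSpace ℝ (Fin 3)} (hv : ‖v‖ = 1) (hw : 1 / 2 ≤ ⟪e, v⟫)
    (hvu : ∀ k, ⟪v, u k⟫ ≤ 1 / 2) : 1 / 2 < ⟪e, v⟫ ^ 2 := by
  by_contra hw2
  rw [not_lt] at hw2
  obtain ⟨b, hb⟩ := exists_orthonormalBasis_third_eq (v := (2 : ℝ) • e)
    (by rw [norm_smul, he]; norm_num)
  have hb2 : b 2 = e := by
    rw [hb, smul_smul]; norm_num
  -- coordinates of the low points
  set X : Fin 6 → ℝ := fun k => ⟪b 0, u k⟫ with hXdef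
  set Y : Fin 6 → ℝ := fun k => ⟪b 1, u k⟫ with hYdef
  set Z : Fin 6 → ℝ := fun k => ⟪b 2, u k⟫ with hZdef
  have hZ0 : ∀ k, 0 ≤ Z k := fun k => by simp only [hZdef, hb2]; exact hz0 k
  have hZ1 : ∀ k, Z k ≤ 1 / 2 := fun k => by simp only [hZdef, hb2]; exact hz1 k
  have hXYZ : ∀ k, X k ^ 2 + Y k ^ 2 + Z k ^ 2 = 1 := by
    intro k
    have h1 : ⟪u k, u k⟫ = 1 := by
      rw [real_inner_self_eq_norm_sq, hn k]; norm_num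
    rw [inner_eq_sum_three b] at h1
    simp only [hXdef, hYdef, hZdef]
    nlinarith [h1]
  set ρ : Fin 6 → ℝ := fun k => ‖(⟨X k, Y k⟩ : ℂ)‖ with hρdef
  set θ : Fin 6 → ℝ := fun k => Complex.arg ⟨X k, Y k⟩ with hθdef
  have hXρ : ∀ k, X k = ρ k * cos (θ k) := fun k => (Complex.norm_mul_cos_arg ⟨X k, Y k⟩).symm
  have hYρ : ∀ k, Y k = ρ k * sin (θ k) := fun k => (Complex.norm_mul_sin_arg ⟨X k, Y k⟩).symm
  have hρ0 : ∀ k, 0 ≤ ρ k := fun k => norm_nonneg _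
  have hρsq : ∀ k, ρ k ^ 2 = 1 - Z k ^ 2 := by
    intro k
    have h1 : ρ k ^ 2 = X k ^ 2 + Y k ^ 2 := by
      simp only [hρdef]
      rw [Complex.sq_norm, Complex.normSq_mk]
      ring
    linarith [hXYZ k]
  have hinner : ∀ i j, ⟪u i, u j⟫ = ρ i * ρ j * cos (θ i - θ j) + Z i * Z j := by
    intro i j
    rw [inner_eq_sum_three b, cos_sub]
    have hXi := hXρ i
    have hXj := hXρ j
    have hYi := hYρ i
    have hYj := hYρ j
    simp only [hXdef, hYdef] at hXi hXj hYi hYj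
    simp only [hZdef]
    rw [hXi, hXj, hYi, hYj]
    ring
  -- coordinates of the northern point
  set P : ℝ := ⟪b 0, v⟫ with hPdef
  set Q : ℝ := ⟪b 1, v⟫ with hQdef
  set W : ℝ := ⟪b 2, v⟫ with hWdef
  have hWe : W = ⟪e, v⟫ := by simp only [hWdef, hb2]
  have hPQW : P ^ 2 + Q ^ 2 + W ^ 2 = 1 := by
    have h1 : ⟪v, v⟫ = 1 := by
      rw [real_inner_self_eq_norm_sq, hv]; norm_num
    rw [inner_eq_sum_three b] at h1
    simp only [hPdef, hQdef, hWdef]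
    nlinarith [h1]
  set r : ℝ := ‖(⟨P, Q⟩ : ℂ)‖ with hrdef
  set φ : ℝ := Complex.arg ⟨P, Q⟩ with hφdef
  have hPr : P = r * cos φ := (Complex.norm_mul_cos_arg ⟨P, Q⟩).symm
  have hQr : Q = r * sin φ := (Complex.norm_mul_sin_arg ⟨P, Q⟩).symm
  have hr0 : 0 ≤ r := norm_nonneg _
  have hrsq : r ^ 2 = 1 - W ^ 2 := by
    have h1 : r ^ 2 = P ^ 2 + Q ^ 2 := by
      simp only [hrdef]
      rw [Complex.sq_norm, Complex.normSq_mk]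
      ring
    linarith [hPQW]
  have hW0 : 1 / 2 ≤ W := by rw [hWe]; exact hw
  have hW1 : W ≤ 1 := by nlinarith [hPQW]
  have hrhalf : 1 / 2 ≤ r ^ 2 := by
    rw [hrsq]; rw [hWe]; linarith
  have hinner' : ∀ k, ⟪v, u k⟫ = r * ρ k * cos (φ - θ k) + W * Z k := by
    intro k
    rw [inner_eq_sum_three b, cos_sub]
    have hXk := hXρ k
    have hYk := hYρ k
    simp only [hXdef, hYdef] at hXk hYk
    simp only [hZdef]
    rw [hXk, hYk]
    have hP' : ⟪b 0, v⟫ = r * cos φ := hPr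
    have hQ' : ⟪b 1, v⟫ = r * sin φ := hQr
    rw [hP', hQ']
    ring
  -- LL: cos (θ i − θ j) ≤ √(1/3); HL: cos (φ − θ k) ≤ √2/2
  have hLL : ∀ i j, i ≠ j → cos (θ i - θ j) ≤ √(1 / 3) := by
    intro i j hij
    have h := hsep i j hij
    rw [hinner] at h
    exact cos_le_sqrt_third_of_low_low (hZ0 i) (hZ1 i) (hZ0 j) (hZ1 j) (hρ0 i) (hρ0 j)
      (hρsq i) (hρsq j) h
  have hHL : ∀ k, cos (φ - θ k) ≤ √2 / 2 := by
    intro k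
    have h := hvu k
    rw [hinner'] at h
    exact cos_le_sqrt_two_div_two hr0 hrhalf
      (mul_cos_le_half_of_high_low (hZ0 k) (hZ1 k) hW0 hW1 hr0 (hρ0 k) (hρsq k) h)
  -- constants
  set G : ℝ := arccos √(1 / 3) with hGdef
  have hGπ : G ≤ π := Real.arccos_le_pi _
  have hcosG : cos G = √(1 / 3) := by
    rw [hGdef, Real.cos_arccos (by linarith [Real.sqrt_nonneg (1 / 3 : ℝ)])
      (by rw [Real.sqrt_le_one]; norm_num)]
  have hGlo : (0.9552 : ℝ) < G := arccos_sqrt_third_bounds.1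
  have hcosq : cos (π / 4) = √2 / 2 := Real.cos_pi_div_four
  -- the angles are pairwise distinct
  have hθinj : Function.Injective θ := by
    intro i j hij
    by_contra hne
    have h := hLL i j hne
    rw [hij, sub_self, Real.cos_zero] at h
    have : √(1 / 3 : ℝ) < 1 := by rw [Real.sqrt_lt' one_pos]; norm_num
    linarith
  -- sort the six angles and apply the budget
  have hAcard : (Finset.univ.image θ).card = 6 := by
    rw [Finset.card_image_of_injective _ hθinj, Finset.card_univ, Fintype.card_fin]
  let emb := (Finset.univ.image θ).orderEmbOfFin hAcard
  have hmem : ∀ k, ∃ i, θ i = emb k := by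
    intro k
    have := (Finset.univ.image θ).orderEmbOfFin_mem hAcard k
    rw [Finset.mem_image] at this
    obtain ⟨i, -, hi⟩ := this
    exact ⟨i, hi⟩
  choose π' hπ' using hmem
  refine six_sorted_angles_one_high_false (fun k => emb k) emb.strictMono ?_ ?_ hGπ hGlo ?_ φ
    (Complex.neg_pi_lt_arg _) (Complex.arg_le_pi _) ?_
  · show -π < emb 0
    rw [← hπ' 0]
    exact Complex.neg_pi_lt_arg _
  · show emb 5 ≤ π
    rw [← hπ' 5]
    exact Complex.arg_le_pi _
  · intro i j hij
    have hne : π' i ≠ π' j := by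
      intro h
      apply hij
      apply emb.injective
      rw [← hπ' i, ← hπ' j, h]
    show cos (emb i - emb j) ≤ cos G
    rw [← hπ' i, ← hπ' j, hcosG]
    exact hLL _ _ hne
  · intro k
    show cos (φ - emb k) ≤ cos (π / 4)
    rw [← hπ' k, hcosq]
    exact hHL _

/-- **Kertész 1994, second step (first half): the three northern points of a nine-point one-sided
arrangement have latitude `> 45°`.**  In the setting of `kertesz1994_ninePointsHemisphere` (nine
unit vectors in the closed hemisphere `⟪e, ·⟫ ≥ 0`, pairwise distances `≥ 1`), every point with
`⟪e, v⟫ > 1/2` has `⟪e, v⟫² > 1/2`, i.e. `⟪e, v⟫ > √2/2 = cos 45°` ("The three 'northern' points are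
shown to have latitude greater than `45°`", Zbl 0822.52005).  From `nine_point_structure` (six low
points) and `half_lt_inner_sq_of_six_low`; the same budget gives colatitude `≤ 43.3°`.  WHAT THIS IS
NOT: the other half (`< 60°`) and the remaining narrowing steps of Kertész's proof.
[cite: Kertesz1994, proof (second step: northern latitudes > 45°)] -/
theorem half_lt_inner_sq_of_high {e : EuclideanSpace ℝ (Fin 3)} (he : ‖e‖ = 1)
    {T : Finset (EuclideanSpace ℝ (Fin 3))}
    (hn : ∀ v ∈ T, ‖v‖ = 1) (hhemi : ∀ v ∈ T, 0 ≤ ⟪e, v⟫)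
    (hsep : ∀ v ∈ T, ∀ w ∈ T, v ≠ w → 1 ≤ dist v w) (h9 : T.card = 9)
    {v : EuclideanSpace ℝ (Fin 3)} (hv : v ∈ T) (hvh : 1 / 2 < ⟪e, v⟫) : 1 / 2 < ⟪e, v⟫ ^ 2 := by
  classical
  obtain ⟨-, hL, -⟩ := nine_point_structure he hn hhemi hsep h9
  set L := T.filter fun u => ⟪e, u⟫ < 1 / 2 with hLdef
  set eqv := (Finset.equivFinOfCardEq hL).symm with heqv
  have hmemL : ∀ k : Fin 6, ((eqv k : L) : EuclideanSpace ℝ (Fin 3)) ∈ L := fun k => (eqv k).2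
  have hi : ∀ {x y}, x ∈ T → y ∈ T → x ≠ y → ⟪x, y⟫ ≤ 1 / 2 := fun hx hy hxy =>
    inner_le_half_of_dist' (hn _ hx) (hn _ hy) (hsep _ hx _ hy hxy)
  refine half_lt_inner_sq_of_six_low he (fun k => ((eqv k : L) : EuclideanSpace ℝ (Fin 3)))
    (fun k => hn _ (Finset.mem_filter.1 (hmemL k)).1)
    (fun k => hhemi _ (Finset.mem_filter.1 (hmemL k)).1)
    (fun k => (Finset.mem_filter.1 (hmemL k)).2.le)
    (fun i j hij => hi (Finset.mem_filter.1 (hmemL i)).1 (Finset.mem_filter.1 (hmemL j)).1 ?_)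
    (hn v hv) hvh.le (fun k => hi hv (Finset.mem_filter.1 (hmemL k)).1 ?_)
  · exact fun h => hij (eqv.injective (Subtype.val_injective h))
  · intro h
    have := (Finset.mem_filter.1 (hmemL k)).2
    rw [← h] at this
    linarith

/-- **Corollary: northern points have horizontal radius `< √2/2`**, i.e. `1 − ⟪e, v⟫² < 1/2` — the
form the azimuth budgets use (`r² = 1 − w²`). [cite: Kertesz1994, proof (second step)] -/
theorem one_sub_inner_sq_lt_half_of_high {e : EuclideanSpace ℝ (Fin 3)} (he : ‖e‖ = 1)
    {T : Finset (EuclideanSpace ℝ (Fin 3))}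
    (hn : ∀ v ∈ T, ‖v‖ = 1) (hhemi : ∀ v ∈ T, 0 ≤ ⟪e, v⟫)
    (hsep : ∀ v ∈ T, ∀ w ∈ T, v ≠ w → 1 ≤ dist v w) (h9 : T.card = 9)
    {v : EuclideanSpace ℝ (Fin 3)} (hv : v ∈ T) (hvh : 1 / 2 < ⟪e, v⟫) :
    1 - ⟪e, v⟫ ^ 2 < 1 / 2 := by
  have := half_lt_inner_sq_of_high he hn hhemi hsep h9 hv hvh
  linarith

end Literature.Geometry.DiscreteGeometry

end
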